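import Summits.CriticalPhenomena.PercolationContinuityZ3.Theorems.PercNearOneGluingNoHeavyQuantGatesWidthSeven
import Summits.CriticalPhenomena.PercolationContinuityZ3.Theorems.PercNearOneGluingNoHeavyQuantWidthEightCellsA
import Summits.CriticalPhenomena.PercolationContinuityZ3.Theorems.PercNearOneGluingNoHeavyQuantWidthEightCellsB
import Summits.CriticalPhenomena.PercolationContinuityZ3.Theorems.PercNearOneGluingNoHeavyQuantEightBlobs
import HarnessLib

/-!
# QUANT lane R8, T-DEC: **CONJECTURE BLOB-AFL FOR EVERY GATE VECTOR OF WIDTH AT MOST 8** — `n ≤ 8` blobs of a common size with ARBITRARY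
# gates `gᵢ ∈ [0,1]` are heavy at their average gate (prim-quant-census-2 gen 83, file 11)

builds on p205010 (kernel theorem, internal audit signed; external expert review pending)

Support file (`--supports stmt-CriticalPhenomena-4575`), QUANT lane census seat prim-quant-census-2 (gen 83); memo
`run/shared/lean/prim/quant/prim-quant-census-2-g83/HOEFFDING-G83.md`.  Theorems only, standard axioms, no sorries, no definitions.

Width 8 of the Hoeffding reduction (`heavy_blobLaw_of_onesEqualFamily`): on top of `heavy_blobLaw_gates_width_le_seven` (`…QuantGatesWidthSeven`)
the new cells are the equal-gates cell `r = 8` (`heavy_blobLaw_replicate_eight`, census-2 g82), the single-low cell `(2,6)` and the cell `(1,7)`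
— three single-low pieces on `(1/7, 3/7]` and the TWO-LOW piece `(3/7, 1/2)` (`heavy_c26`, `heavy_c17a/b/c`, `…QuantWidthEightCellsA`; `heavy_c17d`, `…QuantWidthEightCellsB`); the
reflection cells `g ≥ 1/2` are width-free.  Width 8 is where the equal-gates kernel currently ends.
* `heavy_replicate_le_eight_floor`, `heavy_lowCells_le_eight_floor` — the `m = 0` and the `m ≥ 1`, `g < 1/2` cells up to `m + r ≤ 8`.
* **`heavy_blobLaw_gates_width_le_eight`** — for EVERY gate list `G ⊂ [0,1]` with `|G| ≤ 8` and every blob size `k ≥ 1`, `blobLaw (G.map (k,·))`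
  is heavy at floor `ΣG/|G|` and target `k·ΣG` on `{0..|G|·k}`; `decAtT_blobLaw_gates_width_le_eight`; list forms
  `heavy_blobLaw_of_gates_width_le_eight` / `decAtT_blobLaw_of_gates_width_le_eight` (blob list with all sizes `k`, floor `blobMean/blobTop`).

HONEST STATUS.  Width `≥ 9` OPEN for arbitrary AND for equal gates (equal gates at width 9 need the three-low template, REFLECTION-G82 §0;
the `m ≥ 1` cells of width 9 are `(1,8)`, `(2,7)`, `(3,6)✗`, i.e. `(1,8)` with a two-low piece and `(2,7)` single-low); conjecture C, `SiblingStep`,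
`FarTreeRow`, `GluedLemmaW`, `GluedDominatedMass` OPEN; RATE class (log\*) / honest sentence of `run/shared/lean/prim/quant/README.md` unchanged.
[this work].  Nothing here is cited as a published result.  The gluing rows served [cite: KozmaNitzan2024, Conjecture 3 (p. 15)]; product measure
[cite: Grimmett1999, §1.3 p. 10].
-/


noncomputable section

open scoped BigOperators

namespace Summit.CriticalPhenomena.PercolationContinuityZ3.Theorems
namespace Quant

open Finset

/-- the two-point law `{lo, hi; g}` (as in `…QuantLawDEC`) -/
local notation3 "TP[" lo ", " hi ", " g ", " h "]" =>
  (g : ℝ) * (if (h : ℕ) = (hi : ℕ) then (1 : ℝ) else 0) + (1 - (g : ℝ)) * (if (h : ℕ) = (lo : ℕ) then (1 : ℝ) else 0)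

/-- a HEAVY decomposition of the law `μ` on `{0..M}` at floor `x`, target `T` (the inline `∃` consumed by `decAtT_of_heavy`) -/
local notation3 "HEAVY[" x ", " T ", " M ", " μ "]" =>
  ∃ (ι : Type) (_ : Fintype ι) (lam γ : ι → ℝ) (lo hi : ι → ℕ),
    (∀ i, 0 ≤ lam i) ∧ (∑ i, lam i = 1) ∧ (∀ i, 0 ≤ γ i ∧ γ i ≤ 1) ∧ (∀ i, lo i ≤ hi i) ∧ (∀ i, hi i ≤ (M : ℕ)) ∧
    (∀ h, (μ : ℕ → ℝ) h = ∑ i, lam i * TP[lo i, hi i, γ i, h]) ∧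
    (∀ i, 0 < lam i → (x : ℝ) ≤ γ i ∧ (T : ℝ) ≤ 2 * (lo i : ℝ) + ((hi i : ℝ) - lo i) * γ i)

/-- the blob list of a gate list at the common blob size `k` -/
local notation3 "BL[" k ", " G "]" => LawDec.blobLaw (List.map (fun g : ℝ => ((k : ℕ), g)) G)

namespace LawDec

/-- the equal-gates cells `m = 0`, `r ≤ 8`, `g < 1/2`, at any floor `x ≤ g`. [this work] -/
theorem heavy_replicate_le_eight_floor (k r : ℕ) (hk : 0 < k) {g x : ℝ} (hg0 : 0 < g) (hg1 : g < 1 / 2) (hr : 0 < r) (hr8 : r ≤ 8)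
    (hx : x ≤ g) : HEAVY[x, (k : ℝ) * (r * g), r * k, blobLaw (List.replicate r (k, g))] := by
  rcases Nat.lt_or_ge r 8 with h7 | h8
  · exact heavy_replicate_le_seven_floor k r hk hg0 hg1 hr (by omega) hx
  · have hr8' : r = 8 := le_antisymm hr8 h8
    subst hr8'
    have key := heavy_blobLaw_replicate_eight k hk hg0 (by linarith)
    rw [show (8 : ℝ) * k * g = (k : ℝ) * ((8 : ℕ) * g) by push_cast; ring] at key
    exact heavy_mono _ _ _ _ _ _ hx le_rfl key

/-- the cells `m ≥ 1`, `g < 1/2`, `m + r ≤ 8`, at any floor `x ≤ (m + r g)/(m + r)`, in shifted form. [this work] -/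
theorem heavy_lowCells_le_eight_floor (k m r : ℕ) (hk : 0 < k) {g x : ℝ} (hg1 : g < 1 / 2) (hm : 0 < m) (hmr : m + r ≤ 8)
    (hlow : (m : ℝ) < r * g) (hx : x ≤ ((m : ℝ) + r * g) / ((m : ℝ) + r)) :
    HEAVY[x, (k : ℝ) * (r * g - m), r * k, blobLaw (List.replicate r (k, g))] := by
  have h2m : 2 * m < r := by
    have hr0 : (0 : ℝ) ≤ r := Nat.cast_nonneg r
    have : (2 * m : ℝ) < r := by nlinarith
    exact_mod_cast this
  rcases Nat.lt_or_ge (m + r) 8 with h7 | h8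
  · exact heavy_singleLow_le_seven_floor k m r hk hg1 hm (by omega) hlow hx
  have hcases : (m = 1 ∧ r = 7) ∨ (m = 2 ∧ r = 6) := by omega
  rcases hcases with ⟨rfl, rfl⟩ | ⟨rfl, rfl⟩ <;> push_cast at hlow hx ⊢
  · have hx' : x ≤ ((1 : ℝ) + 7 * g) / 8 := by norm_num at hx; linarith
    rcases le_or_gt g (5 / 21) with h1 | h1
    · exact heavy_mono _ _ _ _ _ _ hx' le_rfl (heavy_c17a k hk (by linarith) h1)
    rcases le_or_gt g (11 / 35) with h2 | h2
    · exact heavy_mono _ _ _ _ _ _ hx' le_rfl (heavy_c17b k hk h1 h2)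
    rcases le_or_gt g (3 / 7) with h3 | h3
    · exact heavy_mono _ _ _ _ _ _ hx' le_rfl (heavy_c17c k hk h2 h3)
    · exact heavy_mono _ _ _ _ _ _ hx' le_rfl (heavy_c17d k hk h3 hg1)
  · have hx' : x ≤ ((2 : ℝ) + 6 * g) / 8 := by norm_num at hx ⊢; linarith
    exact heavy_mono _ _ _ _ _ _ hx' le_rfl (heavy_c26 k hk (by linarith) hg1)

/-- **CONJECTURE BLOB-AFL FOR EVERY GATE VECTOR OF WIDTH AT MOST 8.**  For every gate list `G ⊂ [0,1]` with `|G| ≤ 8` and every blob size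
`k ≥ 1`, the law `blobLaw (G.map (k,·))` of `|G|` blobs of size `k` with gates `G` is heavy at floor `ΣG/|G|` (the AVERAGE gate) and target
`k·ΣG`. [this work] -/
theorem heavy_blobLaw_gates_width_le_eight (k : ℕ) (hk : 0 < k) (G : List ℝ) (hG : ∀ g ∈ G, 0 ≤ g ∧ g ≤ 1) (hn : G.length ≤ 8) :
    HEAVY[G.sum / G.length, (k : ℝ) * G.sum, G.length * k, BL[k, G]] := by
  refine heavy_blobLaw_of_onesEqualFamily k G hG fun m r g hmr hg0 hg1 hS hlow => ?_
  have hr : 0 < r := by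
    rcases Nat.eq_zero_or_pos r with h0 | h0
    · exfalso; subst h0
      simp only [Nat.cast_zero, zero_mul] at hlow
      linarith [Nat.cast_nonneg (α := ℝ) m]
    · exact h0
  have hr' : (0 : ℝ) < r := by exact_mod_cast hr
  have hmr' : ((m : ℝ) + r) ≤ G.length := by exact_mod_cast hmr
  have hmrpos : (0 : ℝ) < (m : ℝ) + r := by positivity
  have hSnn : 0 ≤ (m : ℝ) + r * g := by positivity
  have hx : G.sum / G.length ≤ ((m : ℝ) + r * g) / ((m : ℝ) + r) := by
    rw [← hS]; exact div_le_div_of_nonneg_left hSnn hmrpos hmr'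
  rcases le_or_gt (1 / 2 : ℝ) g with hhalf | hhalf
  · -- reflection cells
    have key := heavy_onesEqual_of_half_le_floor k m r hhalf hg1 hr hx
    rw [hS] at key
    exact key
  rcases Nat.eq_zero_or_pos m with hm0 | hmpos
  · -- equal gates
    subst hm0
    simp only [Nat.cast_zero, zero_add] at hS hx
    have hxg : G.sum / G.length ≤ g := by rwa [mul_div_cancel_left₀ g hr'.ne'] at hx
    have key := heavy_replicate_le_eight_floor k r hk hg0 hhalf hr (by omega) hxg
    rw [hS] at key
    simpa only [List.replicate_zero, List.nil_append, List.map_replicate, zero_add] using key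
  · -- single-low cells, via the shifted form
    have hcell := heavy_lowCells_le_eight_floor k m r hk hhalf hmpos (hmr.trans hn) hlow hx
    have key := heavy_onesEqual_of_shifted k m r g _ hcell
    rw [hS] at key
    exact key

/-- **hence DEC at every layer**, for every gate vector of width at most `8`. [this work] -/
theorem decAtT_blobLaw_gates_width_le_eight (k : ℕ) (hk : 0 < k) (G : List ℝ) (hG : ∀ g ∈ G, 0 ≤ g ∧ g ≤ 1) (hn : G.length ≤ 8)
    (j : ℕ) : DECAtT (G.sum / G.length) ((k : ℝ) * G.sum) j (G.length * k) (blobLaw (List.map (fun g : ℝ => (k, g)) G)) :=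
  decAtT_of_heavy _ _ _ _ (heavy_blobLaw_gates_width_le_eight k hk G hG hn) j

/-- **LIST FORM** (the vocabulary of `heavy_blobLaw_of_mean_le_two` / `heavy_blobLaw_of_half_le_gates`): a blob list with all sizes `= k ≥ 1`,
gates in `[0,1]` and at most `8` blobs is heavy at floor `blobMean l / blobTop l` (its AVERAGE gate) and target `blobMean l`. [this work] -/
theorem heavy_blobLaw_of_gates_width_le_eight (k : ℕ) (hk : 0 < k) (l : List (ℕ × ℝ))
    (hl : ∀ p ∈ l, p.1 = k ∧ 0 ≤ p.2 ∧ p.2 ≤ 1) (hn : l.length ≤ 8) :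
    HEAVY[blobMean l / blobTop l, blobMean l, blobTop l, blobLaw l] := by
  obtain ⟨G, hG, rfl⟩ : ∃ G : List ℝ, (∀ g ∈ G, 0 ≤ g ∧ g ≤ 1) ∧ l = List.map (fun g : ℝ => (k, g)) G := by
    refine ⟨l.map Prod.snd, fun g hg => ?_, eq_map_blobs_of_sizes k l fun p hp => (hl p hp).1⟩
    obtain ⟨p, hp, rfl⟩ := List.mem_map.1 hg
    exact (hl p hp).2
  rw [blobTop_blobs, blobMean_blobs]
  have hn' : G.length ≤ 8 := by simpa using hn
  have key := heavy_blobLaw_gates_width_le_eight k hk G hG hn'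
  rcases Nat.eq_zero_or_pos G.length with h0 | hpos
  · have hGnil : G = [] := List.eq_nil_of_length_eq_zero h0
    subst hGnil
    simpa using key
  · have hk' : (k : ℝ) ≠ 0 := by exact_mod_cast hk.ne'
    have hn0 : (G.length : ℝ) ≠ 0 := by exact_mod_cast hpos.ne'
    have e : (k : ℝ) * G.sum / ((G.length * k : ℕ) : ℝ) = G.sum / G.length := by
      push_cast; field_simp
    rw [e]
    exact key

/-- **hence DEC at every layer**, list form. [this work] -/
theorem decAtT_blobLaw_of_gates_width_le_eight (k : ℕ) (hk : 0 < k) (l : List (ℕ × ℝ))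
    (hl : ∀ p ∈ l, p.1 = k ∧ 0 ≤ p.2 ∧ p.2 ≤ 1) (hn : l.length ≤ 8) (j : ℕ) :
    DECAtT (blobMean l / blobTop l) (blobMean l) j (blobTop l) (blobLaw l) :=
  decAtT_of_heavy _ _ _ _ (heavy_blobLaw_of_gates_width_le_eight k hk l hl hn) j

end LawDec
end Quant
end Summit.CriticalPhenomena.PercolationContinuityZ3.Theorems
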